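import Mathlib.Geometry.Manifold.Instances.Real
import Mathlib.Analysis.InnerProductSpace.Calculus
import Literature.Geometry.Manifold.MaximalAtlasGroupoid
import HarnessLib

/-!
# Reflecting a chart of a `4`-manifold with boundary across a hyperplane (corner faces, Aux 1)

Helper file (`--supports stmt-SmoothPoincare4-18000`, registered helper
`helper_exists_chart_reflect`; auxiliary to the registered helper `helper_cornerChart_faces` of
the skeleton `Cruxes/DependentTripleGenusThreeStandard/Lines/Sketch.lean`, file
`…CornerFaces.lean`, where it puts the two faces of a Gay–Kirby sector at a corner point into the
prescribed order in a chart of the sector piece `W`).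

* `helper_exists_chart_reflect` (REGISTERED) — for a chart `φ` of the maximal `C^∞` atlas of a
  `4`-manifold with boundary `W` (half-space model `EuclideanHalfSpace 4 = {x₀ ≥ 0}`, model with
  corners `𝓡∂ 4`), the reflected chart `R ∘ φ`, `R (x₀,x₁,x₂,x₃) = (x₀,-x₁,x₂,x₃)`, is again in
  the maximal atlas, with the same source: the linear automorphism `R` preserves the half-space,
  so it induces a homeomorphism of the model `EuclideanHalfSpace 4` which, read through `𝓡∂ 4`,
  is `R` on the closed half-space, hence an element of `contDiffGroupoid ∞ (𝓡∂ 4)`; post-composing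
  a chart of the maximal atlas with a groupoid element stays in the maximal atlas
  (`StructureGroupoid.trans_mem_maximalAtlas_of_mem`, `Literature/Geometry/Manifold/MaximalAtlasGroupoid.lean`).

Everything is proved; no definitions, no named facts.

References: J. M. Lee, *Introduction to Smooth Manifolds*, 2nd ed. (2013), Prop. 1.17 (c)
(smooth structures and maximal atlases).
-/

-- the registered namespace `Summit.SmoothPoincare4.SmoothPoincare4.Theorems…` repeats a component
set_option linter.dupNamespace false

noncomputable section

open scoped Manifold ContDiff Topology
open Set Function

namespace Summit.SmoothPoincare4.SmoothPoincare4.Theorems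

/-- **Reflecting a boundary chart across the hyperplane `{x₁ = 0}`.**  For a chart `φ` of the
maximal `C^∞` atlas of a `4`-manifold with boundary (half-space model `{x₀ ≥ 0}`), the chart
`R ∘ φ`, `R (x₀, x₁, x₂, x₃) = (x₀, -x₁, x₂, x₃)`, is again in the maximal atlas (the linear
automorphism `R` preserves the half-space and is an element of `contDiffGroupoid ∞ (𝓡∂ 4)`), with
the same source; its coordinates are `(x₀, -x₁, x₂, x₃)` at every point.
[cite: LeeSmoothManifolds2013, Prop. 1.17] -/
theorem helper_exists_chart_reflect :
    ∀ (W : Type) [TopologicalSpace W] [ChartedSpace (EuclideanHalfSpace 4) W]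
      (φ : OpenPartialHomeomorph W (EuclideanHalfSpace 4)),
      φ ∈ IsManifold.maximalAtlas (𝓡∂ 4) ∞ W →
      ∃ φ' : OpenPartialHomeomorph W (EuclideanHalfSpace 4),
        φ' ∈ IsManifold.maximalAtlas (𝓡∂ 4) ∞ W ∧ φ'.source = φ.source ∧
        ∀ w, (φ' w).val 0 = (φ w).val 0 ∧ (φ' w).val 1 = -(φ w).val 1 ∧
          (φ' w).val 2 = (φ w).val 2 ∧ (φ' w).val 3 = (φ w).val 3 := by
  intro W _ _ φ hφ
  -- the reflection `R` of `ℝ⁴`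
  let R : EuclideanSpace ℝ (Fin 4) → EuclideanSpace ℝ (Fin 4) := fun x => !₂[x 0, -x 1, x 2, x 3]
  have hR0 : ∀ x, R x 0 = x 0 := fun x => rfl
  have hRR : ∀ x, R (R x) = x := by
    intro x
    ext i
    fin_cases i <;> simp [R]
  have hRc : ContDiff ℝ ∞ R := by
    have hc : ∀ i : Fin 4, ContDiff ℝ ∞ fun y : EuclideanSpace ℝ (Fin 4) => y i :=
      fun i => contDiff_euclidean.mp contDiff_id i
    rw [contDiff_euclidean]
    intro i
    fin_cases i
    · exact hc 0
    · exact (hc 1).neg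
    · exact hc 2
    · exact hc 3
  -- the induced homeomorphism of the half-space
  have hRpos : ∀ y : EuclideanHalfSpace 4, 0 ≤ R y.val 0 := fun y => by rw [hR0]; exact y.2
  have hRcont : Continuous fun y : EuclideanHalfSpace 4 => (⟨R y.val, hRpos y⟩ : EuclideanHalfSpace 4) :=
    Continuous.subtype_mk (p := fun x : EuclideanSpace ℝ (Fin 4) => 0 ≤ x 0)
      (hRc.continuous.comp continuous_subtype_val) hRpos
  let Rh : EuclideanHalfSpace 4 ≃ₜ EuclideanHalfSpace 4 :=
    { toFun := fun y => ⟨R y.val, hRpos y⟩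
      invFun := fun y => ⟨R y.val, hRpos y⟩
      left_inv := fun y => Subtype.ext (hRR y.val)
      right_inv := fun y => Subtype.ext (hRR y.val)
      continuous_toFun := hRcont
      continuous_invFun := hRcont }
  have hRh : ∀ y : EuclideanHalfSpace 4, (Rh y).val = R y.val := fun y => rfl
  have hRh' : ∀ y : EuclideanHalfSpace 4, (Rh.symm y).val = R y.val := fun y => rfl
  -- `Rh` read through the model `𝓡∂ 4` is `R` on the closed half-space
  have key : ∀ (f : EuclideanHalfSpace 4 → EuclideanHalfSpace 4)
      (s : Set (EuclideanHalfSpace 4)), (∀ y, (f y).val = R y.val) →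
      ContDiffOn ℝ ∞ ((𝓡∂ 4) ∘ f ∘ (𝓡∂ 4).symm) ((𝓡∂ 4).symm ⁻¹' s ∩ range (𝓡∂ 4)) := by
    intro f s hf
    refine hRc.contDiffOn.congr ?_
    rintro x ⟨-, hx⟩
    show (f ((𝓡∂ 4).symm x)).val = R x
    rw [hf, show ((𝓡∂ 4).symm x).val = (𝓡∂ 4) ((𝓡∂ 4).symm x) from rfl, (𝓡∂ 4).right_inv hx]
  have hmem : Rh.toOpenPartialHomeomorph ∈ contDiffGroupoid ∞ (𝓡∂ 4) := by
    rw [contDiffGroupoid, mem_groupoid_of_pregroupoid]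
    exact ⟨key Rh _ hRh, key Rh.symm _ hRh'⟩
  refine ⟨φ ≫ₕ Rh.toOpenPartialHomeomorph,
    StructureGroupoid.trans_mem_maximalAtlas_of_mem _ hφ hmem, ?_, fun w => ⟨rfl, rfl, rfl, rfl⟩⟩
  rw [OpenPartialHomeomorph.trans_source, Homeomorph.toOpenPartialHomeomorph_source, preimage_univ,
    inter_univ]

end Summit.SmoothPoincare4.SmoothPoincare4.Theorems
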